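import Literature.AnabelianGeometry.EtaleTheta.ClassicalThetaSimpleZeros
import Literature.Combinatorics.Enumerative.JacobiTripleProductAnalytic
import Literature.Combinatorics.Enumerative.JacobiIdentityAnalytic
import Literature.NumberTheory.EllipticCurves.TateCurve.UniformizationThetaZeros
import Mathlib.Analysis.SpecialFunctions.Log.Summable
import Mathlib.Analysis.SpecificLimits.Normed
import HarnessLib

/-!
# [EtTh] Proposition 1.4 "Relation to the Classical Theta Function": the product formula for `Θ̈`

Mochizuki, *The étale theta function and its Frobenioid-theoretic manifestations*, Publ. RIMS **45**
(2009) 227–349, Prop. 1.4 [cite: MochizukiEtTh2009, Prop 1.4 p.21] (PRIMS PDF p. 21–22 = printed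
pp. 247–248). Layer L2 of the abc-iut cell, wave-2 unit W2-L2-02 (seat abc-iut-L2-t6), proof-only
companion of `ClassicalTheta.lean` (abc-iut-L2-t1) and of this seat's `ClassicalThetaZeros.lean`;
no definitions, no named facts. Sequel: `ClassicalThetaProductDerivative.lean` (the derivative at the
cusps in closed form; characteristic 2).

Prop. 1.4 defines `Θ̈(Ü) = Σ_{n ∈ ℤ} (-1)^n q̈^{n(n+1)} Ü^{2n+1}` (`q̈ = q_X^{1/2}`; the tree's
`thetaDdot q̈ Ü`) and refers for its analytic properties ("so `Θ̈` extends uniquely to a meromorphic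
function on `𝔜̈`"; the zeros and poles of (i)) to "the theory of the Tate curve [cf., e.g., [Mumf],
pp. 306-307]" (D. Mumford, *An analytic construction of degenerating abelian varieties over complete
rings*, appendix to Faltings–Chai). The classical content behind that reference is JACOBI'S TRIPLE
PRODUCT, which the tree proves at every point of a complete normed field
(`Literature.Combinatorics.Enumerative.JacobiTripleProductAnalytic.hasSum_jacobi_triple_zpow`,
Hardy–Wright Thm 352), together with JACOBI'S IDENTITY `∏ (1 − xⁿ)³ = Σ (−1)ᵐ (2m+1) x^{m(m+1)/2}`
(`…JacobiIdentityAnalytic.hasSum_jacobi`, Hardy–Wright Thm 357). This file draws the consequences for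
`Θ̈`, in EVERY complete normed field `𝕜` (archimedean or not, any characteristic), `‖q̈‖ < 1`:

* `thetaDdot_eq_tprod` — **the product formula** (`q̈ ≠ 0`, `Ü ≠ 0`):
  `Θ̈(Ü) = (Ü − Ü⁻¹) · ∏_{n ≥ 1} (1 − q̈^{2n}) (1 − q̈^{2n} Ü²) (1 − q̈^{2n} Ü⁻²)`
  (substitute `x = q̈`, `z = −q̈Ü²` in the triple product — `thetaDdot_eq_mul_tprod` — and peel off the
  factor `1 − Ü⁻²`); `exists_hasProd_thetaDdot` records that the displayed product converges;
* `thetaDdot_eq_zero_iff_of_norm_lt_one` — **Prop. 1.4 (i), the zero locus, uniformly over every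
  complete normed field**: `Θ̈(Ü) = 0 ↔ Ü = ±q̈^a`, `a ∈ ℤ` (a convergent product vanishes iff a factor
  does). The tree previously had this over `ℂ` (`thetaDdot_eq_zero_iff_complex`, t1) and over complete
  ULTRAMETRIC fields (`thetaDdot_eq_zero_iff`, this seat) by two different arguments;
* `thetaDdotAux_one_eq_tprod_pow_three` — the value at `1` of the auxiliary function `H` of
  `ClassicalThetaZeros` (`Θ̈(Ü) = Ü (Ü² − 1) H(Ü)`) in closed form: **`H(1) = ∏_{n ≥ 1} (1 − q̈^{2n})³`**
  (fold the `ℤ`-indexed series along `n ↔ −(n+1)` onto Jacobi's identity at `x = q̈²`); in particular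
  `H(1) ≠ 0` in every complete normed field (`thetaDdotAux_one_ne_zero'`). The sequel turns this into
  `Θ̈′(1) = 2 ∏ (1 − q̈^{2n})³` (the Tate-curve form of Jacobi's `ϑ₁′ = 2 q^{1/4} G³`).

Everything here is classical (Jacobi 1829; Hardy–Wright §19.8–19.9) and undisputed; the paper's
`K̈ ⊇ ℚ_p` is a complete ultrametric field of characteristic `0`, where all statements apply.
HONEST FRAMING: this file takes no side on any disputed claim of the IUT corpus; typed ≠ endorsed.
-/

noncomputable section

namespace Literature.AnabelianGeometry.EtaleTheta

open Filter Finset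
open scoped Topology
open Literature.Combinatorics.Enumerative.JacobiTripleProductAnalytic (hasSum_jacobi_triple_zpow)
open Literature.Combinatorics.Enumerative.JacobiIdentityAnalytic (hasSum_jacobi)

/-! ### Infinite products `∏ (1 − gₙ)` with `Σ ‖gₙ‖ < ∞` in a complete normed field -/

section Products

variable {𝕜 : Type*} [NormedField 𝕜] [CompleteSpace 𝕜]

/-- `∏ (1 − gₙ)` converges when `Σ ‖gₙ‖ < ∞`. [folklore] -/
private theorem multipliable_one_sub_of_summable_norm {g : ℕ → 𝕜} (hg : Summable fun n => ‖g n‖) :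
    Multipliable fun n => 1 - g n := by
  have h := multipliable_one_add_of_summable (f := fun n => -g n) (by simpa using hg)
  simpa [sub_eq_add_neg] using h

/-- `∏ (1 − gₙ) ≠ 0` when `Σ ‖gₙ‖ < ∞` and no factor vanishes (the tree's `tprod_one_add_ne_zero`).
[folklore] -/
private theorem tprod_one_sub_ne_zero {g : ℕ → 𝕜} (hg : Summable fun n => ‖g n‖)
    (h : ∀ n, 1 - g n ≠ 0) : ∏' n, (1 - g n) ≠ 0 := by
  have h' := Literature.NumberTheory.EllipticCurves.TateCurve.tprod_one_add_ne_zero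
    (f := fun n => -g n) (by simpa using hg) (fun n => by simpa [sub_eq_add_neg] using h n)
  simpa [sub_eq_add_neg] using h'

/-- A vanishing convergent product `∏ (1 − gₙ) = 0` (`Σ ‖gₙ‖ < ∞`) has a vanishing factor. [folklore] -/
private theorem exists_eq_zero_of_tprod_one_sub_eq_zero {g : ℕ → 𝕜} (hg : Summable fun n => ‖g n‖)
    (h : ∏' n, (1 - g n) = 0) : ∃ n, 1 - g n = 0 := by
  by_contra hne
  exact tprod_one_sub_ne_zero hg (fun n h0 => hne ⟨n, h0⟩) h

variable {q2 : 𝕜}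

omit [CompleteSpace 𝕜] in
/-- `Σₙ ‖q̈^{2(n+1)} c‖ < ∞` for `‖q̈‖ < 1`. [folklore] -/
private theorem summable_norm_qpow_succ_mul (hq : ‖q2‖ < 1) (c : 𝕜) :
    Summable fun n : ℕ => ‖q2 ^ (2 * (n + 1)) * c‖ := by
  have hq2 : ‖q2‖ ^ 2 < 1 := by
    simpa using pow_lt_one₀ (norm_nonneg q2) hq two_ne_zero
  have hgeo := summable_geometric_of_lt_one (sq_nonneg ‖q2‖) hq2
  refine ((hgeo.mul_left (‖q2‖ ^ 2 * ‖c‖))).congr fun n => ?_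
  rw [norm_mul, norm_pow, pow_mul, pow_succ]
  ring

omit [CompleteSpace 𝕜] in
/-- `Σₙ ‖q̈^{2(n+1)}‖ < ∞` for `‖q̈‖ < 1`. [folklore] -/
private theorem summable_norm_qpow_succ (hq : ‖q2‖ < 1) :
    Summable fun n : ℕ => ‖q2 ^ (2 * (n + 1))‖ := by
  simpa using summable_norm_qpow_succ_mul hq 1

omit [CompleteSpace 𝕜] in
/-- No factor `1 − q̈^{2(n+1)}` vanishes (`‖q̈‖ < 1`). [folklore] -/
private theorem one_sub_qpow_succ_ne_zero (hq : ‖q2‖ < 1) (n : ℕ) : 1 - q2 ^ (2 * (n + 1)) ≠ 0 := by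
  intro h
  have h1 : ‖q2 ^ (2 * (n + 1))‖ = 1 := by rw [(sub_eq_zero.mp h).symm, norm_one]
  have h2 : ‖q2 ^ (2 * (n + 1))‖ < 1 := by
    rw [norm_pow]
    exact pow_lt_one₀ (norm_nonneg q2) hq (by omega)
  exact absurd h1 h2.ne

/-- `∏_{n ≥ 1} (1 − q̈^{2n}) ≠ 0` (`‖q̈‖ < 1`): no factor of the constant part of the product formula
vanishes. (Elementary; auxiliary for Prop. 1.4 (i).) [cite: MochizukiEtTh2009, Prop 1.4 (i) p.21] -/
theorem tprod_one_sub_qpow_succ_ne_zero (hq : ‖q2‖ < 1) : ∏' n : ℕ, (1 - q2 ^ (2 * (n + 1))) ≠ 0 :=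
  tprod_one_sub_ne_zero (g := fun n => q2 ^ (2 * (n + 1))) (summable_norm_qpow_succ hq)
    (one_sub_qpow_succ_ne_zero hq)

/-- `∏_{n ≥ 1} (1 − q̈^{2n})³ ≠ 0` (`‖q̈‖ < 1`) — the value `H(1)` (below) and `Θ̈′(1)/2` (sequel) is
non-zero. (Elementary; auxiliary for Prop. 1.4 (i).) [cite: MochizukiEtTh2009, Prop 1.4 (i) p.21] -/
theorem tprod_one_sub_qpow_succ_pow_three_ne_zero (hq : ‖q2‖ < 1) :
    (∏' n : ℕ, (1 - q2 ^ (2 * (n + 1)))) ^ 3 ≠ 0 :=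
  pow_ne_zero 3 (tprod_one_sub_qpow_succ_ne_zero hq)

end Products

/-! ### The product formula ([Mumf] pp. 306–307 as cited in Prop. 1.4; Jacobi's triple product) -/

section ProductFormula

variable {𝕜 : Type*} [NormedField 𝕜] [CompleteSpace 𝕜] {q2 U : 𝕜}

omit [CompleteSpace 𝕜] in
/-- The general term of `Θ̈` is `Ü` times the general term `zʲ x^{j²}` of Jacobi's triple product at
`x = q̈`, `z = −q̈Ü²`: `(−1)ʲ q̈^{j(j+1)} Ü^{2j+1} = Ü · (−q̈Ü²)ʲ q̈^{j²}`.
[cite: MochizukiEtTh2009, Prop 1.4 p.21] -/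
theorem thetaDdotTerm_eq_mul_jacobiTerm (hq0 : q2 ≠ 0) (hU : U ≠ 0) (j : ℤ) :
    thetaDdotTerm q2 U j = U * ((-(q2 * U ^ 2)) ^ j * q2 ^ (j ^ 2).toNat) := by
  have h1 : (-(q2 * U ^ 2)) ^ j = ((j.negOnePow : ℤ) : 𝕜) * (q2 ^ j * U ^ (2 * j)) := by
    rw [neg_eq_neg_one_mul, mul_zpow, mul_zpow, Int.cast_negOnePow, zpow_mul, zpow_ofNat]
  have h2 : (q2 ^ (j ^ 2).toNat : 𝕜) = q2 ^ (j * j) := by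
    rw [← zpow_natCast, Int.toNat_of_nonneg (sq_nonneg j), sq]
  rw [thetaDdotTerm, h1, h2, show j * (j + 1) = j + j * j by ring, zpow_add₀ hq0,
    zpow_add_one₀ hU]
  ring

/-- **The triple product applied to `Θ̈`** (asymmetric form, straight from Hardy–Wright Thm 352 with
`x = q̈`, `z = −q̈Ü²`): for `‖q̈‖ < 1`, `q̈ ≠ 0`, `Ü ≠ 0`,
`Θ̈(Ü) = Ü · ∏_{n ≥ 0} (1 − q̈^{2n+2}) (1 − q̈^{2n+2} Ü²) (1 − q̈^{2n} Ü⁻²)`.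
[cite: MochizukiEtTh2009, Prop 1.4 p.21] -/
theorem thetaDdot_eq_mul_tprod (hq : ‖q2‖ < 1) (hq0 : q2 ≠ 0) (hU : U ≠ 0) :
    thetaDdot q2 U = U * ∏' n : ℕ, ((1 - q2 ^ (2 * (n + 1))) * (1 - q2 ^ (2 * (n + 1)) * U ^ 2) *
      (1 - q2 ^ (2 * n) * U⁻¹ ^ 2)) := by
  have hz : -(q2 * U ^ 2) ≠ 0 := neg_ne_zero.mpr (mul_ne_zero hq0 (pow_ne_zero 2 hU))
  have h := (hasSum_jacobi_triple_zpow hz hq).mul_left U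
  have hfun : (fun j : ℤ => U * ((-(q2 * U ^ 2)) ^ j * q2 ^ (j ^ 2).toNat)) = thetaDdotTerm q2 U :=
    funext fun j => (thetaDdotTerm_eq_mul_jacobiTerm hq0 hU j).symm
  rw [hfun] at h
  rw [thetaDdot, h.tsum_eq]
  congr 1
  refine tprod_congr fun n => ?_
  have e1 : 1 + -(q2 * U ^ 2) * q2 ^ (2 * n + 1) = 1 - q2 ^ (2 * (n + 1)) * U ^ 2 := by ring
  have e2 : 1 + (-(q2 * U ^ 2))⁻¹ * q2 ^ (2 * n + 1) = 1 - q2 ^ (2 * n) * U⁻¹ ^ 2 := by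
    rw [inv_neg, mul_inv, pow_succ q2 (2 * n), inv_pow,
      show -(q2⁻¹ * (U ^ 2)⁻¹) * (q2 ^ (2 * n) * q2) = -((q2⁻¹ * q2) * (q2 ^ (2 * n) * (U ^ 2)⁻¹)) by
        ring,
      inv_mul_cancel₀ hq0, one_mul, ← sub_eq_add_neg]
  rw [e1, e2]

/-- The three convergent products: `∏ (1 − q̈^{2n+2})`, `∏ (1 − q̈^{2n+2} c)`. [folklore] -/
private theorem multipliable_one_sub_qpow_succ_mul (hq : ‖q2‖ < 1) (c : 𝕜) :
    Multipliable fun n : ℕ => 1 - q2 ^ (2 * (n + 1)) * c :=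
  multipliable_one_sub_of_summable_norm (summable_norm_qpow_succ_mul hq c)

/-- `∏ (1 − q̈^{2n+2})` converges. [folklore] -/
private theorem multipliable_one_sub_qpow_succ (hq : ‖q2‖ < 1) :
    Multipliable fun n : ℕ => (1 : 𝕜) - q2 ^ (2 * (n + 1)) :=
  multipliable_one_sub_of_summable_norm (summable_norm_qpow_succ hq)

/-- The product of the three factors splits: `∏ AₙBₙCₙ = (∏ Aₙ)(∏ Bₙ)(∏ Cₙ)`. [folklore] -/
private theorem tprod_three_eq (hq : ‖q2‖ < 1) (b c : 𝕜) :
    ∏' n : ℕ, ((1 - q2 ^ (2 * (n + 1))) * (1 - q2 ^ (2 * (n + 1)) * b) * (1 - q2 ^ (2 * (n + 1)) * c)) =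
      (∏' n : ℕ, (1 - q2 ^ (2 * (n + 1)))) * (∏' n : ℕ, (1 - q2 ^ (2 * (n + 1)) * b)) *
        ∏' n : ℕ, (1 - q2 ^ (2 * (n + 1)) * c) :=
  (((multipliable_one_sub_qpow_succ hq).hasProd.mul (multipliable_one_sub_qpow_succ_mul hq b).hasProd).mul
    (multipliable_one_sub_qpow_succ_mul hq c).hasProd).tprod_eq

/-- **The product formula for `Θ̈` (Prop. 1.4 "Relation to the Classical Theta Function"; [Mumf]
pp. 306–307; Jacobi's triple product)**: in every complete normed field, for `‖q̈‖ < 1`, `q̈ ≠ 0`,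
`Ü ≠ 0`,
`Θ̈(Ü) = (Ü − Ü⁻¹) · ∏_{n ≥ 1} (1 − q̈^{2n}) (1 − q̈^{2n} Ü²) (1 − q̈^{2n} Ü⁻²)`.
[cite: MochizukiEtTh2009, Prop 1.4 p.21] -/
theorem thetaDdot_eq_tprod (hq : ‖q2‖ < 1) (hq0 : q2 ≠ 0) (hU : U ≠ 0) :
    thetaDdot q2 U = (U - U⁻¹) * ∏' n : ℕ, ((1 - q2 ^ (2 * (n + 1))) *
      (1 - q2 ^ (2 * (n + 1)) * U ^ 2) * (1 - q2 ^ (2 * (n + 1)) * U⁻¹ ^ 2)) := by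
  set C : ℕ → 𝕜 := fun n => 1 - q2 ^ (2 * n) * U⁻¹ ^ 2 with hC
  have hA := (multipliable_one_sub_qpow_succ hq).hasProd
  have hB := (multipliable_one_sub_qpow_succ_mul hq (U ^ 2)).hasProd
  have hC' : HasProd (fun n => C (n + 1)) (∏' n : ℕ, (1 - q2 ^ (2 * (n + 1)) * U⁻¹ ^ 2)) :=
    (multipliable_one_sub_qpow_succ_mul hq (U⁻¹ ^ 2)).hasProd
  have hCprod : HasProd C (C 0 * ∏' n : ℕ, (1 - q2 ^ (2 * (n + 1)) * U⁻¹ ^ 2)) := hC'.zero_mul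
  have h3 := ((hA.mul hB).mul hCprod).tprod_eq
  have hC0 : C 0 = 1 - U⁻¹ ^ 2 := by simp [hC]
  rw [thetaDdot_eq_mul_tprod hq hq0 hU, tprod_three_eq hq]
  rw [show (fun n : ℕ => (1 - q2 ^ (2 * (n + 1))) * (1 - q2 ^ (2 * (n + 1)) * U ^ 2) *
      (1 - q2 ^ (2 * n) * U⁻¹ ^ 2)) = fun n => (1 - q2 ^ (2 * (n + 1))) *
      (1 - q2 ^ (2 * (n + 1)) * U ^ 2) * C n from rfl, h3, hC0]
  have hUU : U - U⁻¹ = U * (1 - U⁻¹ ^ 2) := by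
    field_simp
  rw [hUU]
  ring

/-- The same with the convergence made explicit (the displayed product CONVERGES; it is not merely
a `tprod` by convention): there is `P` with
`HasProd (n ↦ (1 − q̈^{2n+2})(1 − q̈^{2n+2}Ü²)(1 − q̈^{2n+2}Ü⁻²)) P` and `Θ̈(Ü) = (Ü − Ü⁻¹) P`.
[cite: MochizukiEtTh2009, Prop 1.4 p.21] -/
theorem exists_hasProd_thetaDdot (hq : ‖q2‖ < 1) (hq0 : q2 ≠ 0) (hU : U ≠ 0) :
    ∃ P : 𝕜, HasProd (fun n : ℕ => (1 - q2 ^ (2 * (n + 1))) *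
      (1 - q2 ^ (2 * (n + 1)) * U ^ 2) * (1 - q2 ^ (2 * (n + 1)) * U⁻¹ ^ 2)) P ∧
      thetaDdot q2 U = (U - U⁻¹) * P :=
  ⟨_, (((multipliable_one_sub_qpow_succ hq).hasProd.mul
    (multipliable_one_sub_qpow_succ_mul hq (U ^ 2)).hasProd).mul
    (multipliable_one_sub_qpow_succ_mul hq (U⁻¹ ^ 2)).hasProd),
    by rw [thetaDdot_eq_tprod hq hq0 hU, tprod_three_eq hq]⟩

end ProductFormula

/-! ### Prop. 1.4 (i), the zero locus — uniformly over every complete normed field -/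

section ZeroLocus

variable {𝕜 : Type*} [NormedField 𝕜] [CompleteSpace 𝕜] {q2 U : 𝕜}

omit [CompleteSpace 𝕜] in
/-- In a field, `(q̈^{n+1} V)² = 1` forces `V = ±q̈^{-(n+1)}`. [folklore] -/
private theorem eq_zpow_or_of_sq_eq_one {V : 𝕜} (n : ℕ)
    (h : q2 ^ (2 * (n + 1)) * V ^ 2 = 1) :
    V = q2 ^ (-((n : ℤ) + 1)) ∨ V = -(q2 ^ (-((n : ℤ) + 1))) := by
  have hsq : (q2 ^ (n + 1) * V) ^ 2 = 1 := by rw [mul_pow, ← pow_mul, mul_comm (n + 1) 2, h]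
  have hinv : q2 ^ (-((n : ℤ) + 1)) = (q2 ^ (n + 1))⁻¹ := by
    rw [show -((n : ℤ) + 1) = -((n + 1 : ℕ) : ℤ) by push_cast; ring, zpow_neg, zpow_natCast]
  rw [hinv]
  rcases sq_eq_one_iff.mp hsq with h1 | h1
  · exact Or.inl (inv_eq_of_mul_eq_one_right h1).symm
  · refine Or.inr ?_
    have h2 : q2 ^ (n + 1) * (-V) = 1 := by rw [mul_neg, h1, neg_neg]
    have := inv_eq_of_mul_eq_one_right h2
    rw [this, neg_neg]

/-- **Prop. 1.4 (i), zero locus, over EVERY complete normed field** (archimedean or not, any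
characteristic): for `0 < ‖q̈‖ < 1` and `Ü ≠ 0`, `Θ̈(Ü) = 0 ↔ Ü = ±q̈^a` for some `a ∈ ℤ` — "the
zeroes of `Θ̈` on `𝔜̈` are precisely the cusps of `𝔜̈`" at the level of points. From the product
formula: a convergent product vanishes iff a factor does, and the factors vanish exactly at
`Ü² = q̈^{2a}`. (Subsumes `thetaDdot_eq_zero_iff_complex` and the ultrametric `thetaDdot_eq_zero_iff`.)
[cite: MochizukiEtTh2009, Prop 1.4 (i) p.21] -/
theorem thetaDdot_eq_zero_iff_of_norm_lt_one (hq : ‖q2‖ < 1) (hq0 : q2 ≠ 0) (hU : U ≠ 0) :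
    thetaDdot q2 U = 0 ↔ ∃ a : ℤ, U = q2 ^ a ∨ U = -(q2 ^ a) := by
  constructor
  · intro h
    rw [thetaDdot_eq_tprod hq hq0 hU, tprod_three_eq hq, mul_eq_zero, mul_eq_zero, mul_eq_zero] at h
    rcases h with h | (h | h) | h
    · -- `Ü − Ü⁻¹ = 0`: `Ü = ±1 = ±q̈⁰`
      refine ⟨0, ?_⟩
      have hsq : U ^ 2 = 1 := by
        have : U * (U - U⁻¹) = 0 := by rw [h, mul_zero]
        rw [mul_sub, mul_inv_cancel₀ hU] at this
        rw [sq]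
        exact sub_eq_zero.mp this
      simpa using sq_eq_one_iff.mp hsq
    · exact absurd h (tprod_one_sub_qpow_succ_ne_zero hq)
    · -- a factor `1 − q̈^{2(n+1)} Ü² = 0`: `Ü = ±q̈^{-(n+1)}`
      obtain ⟨n, hn⟩ := exists_eq_zero_of_tprod_one_sub_eq_zero (summable_norm_qpow_succ_mul hq _) h
      exact ⟨-((n : ℤ) + 1), eq_zpow_or_of_sq_eq_one n (sub_eq_zero.mp hn).symm⟩
    · -- a factor `1 − q̈^{2(n+1)} Ü⁻² = 0`: `Ü = ±q̈^{n+1}`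
      obtain ⟨n, hn⟩ := exists_eq_zero_of_tprod_one_sub_eq_zero (summable_norm_qpow_succ_mul hq _) h
      have h' : q2 ^ (2 * (n + 1)) * U⁻¹ ^ 2 = 1 := (sub_eq_zero.mp hn).symm
      refine ⟨(n : ℤ) + 1, ?_⟩
      have e : q2 ^ ((n : ℤ) + 1) = (q2 ^ (-((n : ℤ) + 1)))⁻¹ := by rw [zpow_neg, inv_inv]
      rcases eq_zpow_or_of_sq_eq_one n h' with h1 | h1
      · exact Or.inl (by rw [e, ← h1, inv_inv])
      · exact Or.inr (by rw [e, show q2 ^ (-((n : ℤ) + 1)) = -U⁻¹ by rw [h1, neg_neg], inv_neg,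
          inv_inv, neg_neg])
  · rintro ⟨a, rfl | rfl⟩
    · exact thetaDdot_zpow_of_norm_lt_one hq hq0 a
    · exact thetaDdot_neg_zpow_of_norm_lt_one hq hq0 a

end ZeroLocus

/-! ### The value `H(1) = ∏ (1 − q̈^{2n})³` (Jacobi's identity) and `Θ̈′(1)` in closed form -/

section AuxValue

variable {𝕜 : Type*} [NormedField 𝕜] {q2 : 𝕜}

/-- `G_n(1) = n` for the two-sided geometric sum of `ClassicalThetaZeros`. [folklore] -/
private theorem geomSumZ_one (n : ℤ) : geomSumZ (1 : 𝕜) n = n := by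
  cases n with
  | ofNat n => simp [Int.ofNat_eq_natCast, geomSumZ_natCast]
  | negSucc m => simp [geomSumZ_negSucc, Int.cast_negSucc]

/-- The auxiliary term at `Ü = 1`: `(−1)ⁿ n q̈^{n(n+1)}`. [cite: MochizukiEtTh2009, Prop 1.4 (i) p.21] -/
theorem thetaDdotAuxTerm_one (n : ℤ) :
    thetaDdotAuxTerm q2 1 n = ((n.negOnePow : ℤ) : 𝕜) * q2 ^ (n * (n + 1)) * n := by
  rw [thetaDdotAuxTerm, one_pow, geomSumZ_one]

/-- The terms `n` and `−(n+1)` of `H(1)` add up to Jacobi's `(−1)ⁿ (2n+1) q̈^{n(n+1)}`.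
[cite: MochizukiEtTh2009, Prop 1.4 (i) p.21] -/
theorem thetaDdotAuxTerm_one_add_neg_succ (n : ℕ) :
    thetaDdotAuxTerm q2 1 n + thetaDdotAuxTerm q2 1 (-(n + 1)) =
      (-1 : 𝕜) ^ n * (2 * n + 1) * (q2 ^ 2) ^ (n * (n + 1) / 2) := by
  have hev : (q2 ^ 2) ^ (n * (n + 1) / 2) = q2 ^ (n * (n + 1)) := by
    rw [← pow_mul, Nat.two_mul_div_two_of_even (Nat.even_mul_succ_self n)]
  have e1 : thetaDdotAuxTerm q2 1 n = (-1 : 𝕜) ^ n * q2 ^ (n * (n + 1)) * n := by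
    rw [thetaDdotAuxTerm_one, natCast_mul_natCast_add_one, zpow_natCast, Int.cast_negOnePow_natCast,
      Int.cast_natCast]
  have e2 : thetaDdotAuxTerm q2 1 (-(n + 1)) = -((-1 : 𝕜) ^ n * q2 ^ (n * (n + 1)) * (-(n + 1))) := by
    rw [show (-(n + 1 : ℤ)) = Int.negSucc n from rfl, thetaDdotAuxTerm_one, negSucc_mul_negSucc_add_one,
      zpow_natCast, Int.negSucc_eq, Int.negOnePow_neg, Int.negOnePow_succ, Units.val_neg,
      Int.cast_neg, Int.cast_negOnePow_natCast]
    push_cast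
    ring
  rw [e1, e2, hev]
  ring

variable [CompleteSpace 𝕜]

/-- Summability of `H(1) = Σ (−1)ⁿ n q̈^{n(n+1)}` (`‖q̈‖ < 1`): both halves are dominated by
`(n+1) ‖q̈‖ⁿ`. [cite: MochizukiEtTh2009, Prop 1.4 (i) p.21] -/
theorem summable_thetaDdotAuxTerm_one (hq : ‖q2‖ < 1) : Summable (thetaDdotAuxTerm q2 (1 : 𝕜)) := by
  have hq' : ‖(‖q2‖ : ℝ)‖ < 1 := by rwa [norm_norm]
  -- the majorant `(n + 1) ‖q̈‖ⁿ`
  have hmaj : Summable fun n : ℕ => ((n : ℝ) + 1) * ‖q2‖ ^ n := by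
    have h1 := summable_pow_mul_geometric_of_norm_lt_one 1 hq'
    have h0 := summable_geometric_of_lt_one (norm_nonneg q2) hq
    simpa [add_mul] using h1.add h0
  have hnorm : ∀ n : ℤ, ‖thetaDdotAuxTerm q2 (1 : 𝕜) n‖ = ‖(n : 𝕜)‖ * ‖q2‖ ^ (n * (n + 1)) := by
    intro n
    rw [thetaDdotAuxTerm_one, norm_mul, norm_mul, Int.cast_negOnePow, norm_zpow, norm_neg, norm_one,
      one_zpow, one_mul, norm_zpow, mul_comm]
  have hcast : ∀ n : ℕ, ‖(n : 𝕜)‖ ≤ n := fun n => by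
    simpa using Nat.norm_cast_le (α := 𝕜) n
  have hpow : ∀ n : ℕ, ‖q2‖ ^ (n * (n + 1)) ≤ ‖q2‖ ^ n := fun n =>
    pow_le_pow_of_le_one (norm_nonneg _) hq.le (Nat.le_mul_of_pos_right n (Nat.succ_pos n))
  refine Summable.of_nat_of_neg_add_one ?_ ?_
  · refine Summable.of_norm_bounded hmaj fun n => ?_
    rw [hnorm, natCast_mul_natCast_add_one, zpow_natCast, Int.cast_natCast]
    calc ‖(n : 𝕜)‖ * ‖q2‖ ^ (n * (n + 1)) ≤ n * ‖q2‖ ^ n :=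
          mul_le_mul (hcast n) (hpow n) (pow_nonneg (norm_nonneg _) _) (Nat.cast_nonneg n)
      _ ≤ (n + 1) * ‖q2‖ ^ n := by gcongr; linarith
  · refine Summable.of_norm_bounded hmaj fun n => ?_
    rw [hnorm, show (-((n : ℤ) + 1)) = Int.negSucc n from rfl, negSucc_mul_negSucc_add_one, zpow_natCast,
      Int.cast_negSucc, norm_neg]
    calc ‖((n + 1 : ℕ) : 𝕜)‖ * ‖q2‖ ^ (n * (n + 1)) ≤ ((n + 1 : ℕ) : ℝ) * ‖q2‖ ^ n :=
          mul_le_mul (hcast (n + 1)) (hpow n) (pow_nonneg (norm_nonneg _) _) (Nat.cast_nonneg _)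
      _ = ((n : ℝ) + 1) * ‖q2‖ ^ n := by push_cast; ring

/-- **`H(1) = ∏_{n ≥ 1} (1 − q̈^{2n})³`** (every complete normed field, `‖q̈‖ < 1`): fold the
`ℤ`-indexed series of `H(1)` along `n ↔ −(n+1)` and apply Jacobi's identity (Hardy–Wright Thm 357)
at `x = q̈²`. [cite: MochizukiEtTh2009, Prop 1.4 (i) p.21] -/
theorem thetaDdotAux_one_eq_tprod_pow_three (hq : ‖q2‖ < 1) :
    thetaDdotAux q2 (1 : 𝕜) = (∏' n : ℕ, (1 - q2 ^ (2 * (n + 1)))) ^ 3 := by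
  have hq2 : ‖q2 ^ 2‖ < 1 := by
    rw [norm_pow]
    exact pow_lt_one₀ (norm_nonneg q2) hq two_ne_zero
  have hH : HasSum (thetaDdotAuxTerm q2 (1 : 𝕜)) (thetaDdotAux q2 1) :=
    (summable_thetaDdotAuxTerm_one hq).hasSum
  have hfold := hH.nat_add_neg_add_one
  simp only [thetaDdotAuxTerm_one_add_neg_succ] at hfold
  have hJ := hasSum_jacobi hq2
  simp only [← pow_mul] at hJ hfold
  rw [hfold.unique hJ]

/-- `∏ (1 − q̈^{2n})³ ≠ 0`, so `H(1) ≠ 0` in every complete normed field (the ultrametric case,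
with `‖H(1)‖ = 1`, is `thetaDdotAux_one_ne_zero`). [cite: MochizukiEtTh2009, Prop 1.4 (i) p.21] -/
theorem thetaDdotAux_one_ne_zero' (hq : ‖q2‖ < 1) : thetaDdotAux q2 (1 : 𝕜) ≠ 0 := by
  rw [thetaDdotAux_one_eq_tprod_pow_three hq]
  exact pow_ne_zero 3 (tprod_one_sub_qpow_succ_ne_zero hq)

end AuxValue

end Literature.AnabelianGeometry.EtaleTheta
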